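import Mathlib
import Summits.Ventures.HodgeRepro.Tier4.Target
import Summits.Ventures.HodgeRepro.Tier4.Line3.Defs
import Summits.Ventures.HodgeRepro.Tier4.Line3.LocaliserS
import Summits.Ventures.HodgeRepro.Tier4.Line3.ClassBoundGauss
import Summits.Ventures.HodgeRepro.Tier4.Line3.ClassBoundDef
import Summits.Ventures.HodgeRepro.Tier4.Line3.LatticeGaussDefs
import Summits.Ventures.HodgeRepro.Tier4.Line3.LatticeEmbedLemmas
import Summits.Ventures.HodgeRepro.Tier4.Line3.LatticeGaussPointwise

/-!
# Tier4/Line3/LatticeGaussSum — THE LATTICE GAUSSIAN SUM (rung (R2) of L3.5's residual)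

Blind re-derivation cell `pub-hodge-repro`, Tier 4 «PROVE THE STEP» (README §9–§10), LINE L3, seat t4-x2 (reserve
wall-breaker) on (R2) of L3.5's residual (lead g385 S12860 (R-IV); L2-p1's census S12833: «a theta-series bound over
a ℤ-lattice … Mathlib `ZLattice.summable_norm_rpow` after bounding the Gaussian by an inverse power»).

THE THETA BOUND.  For a finitely generated `𝒪_{E′}`-submodule `L ⊆ E′³` the per-vector factors of the majorant with the
definite Gaussians (`vecFactor c₁ e v z`, LatticeGaussPointwise) are SUMMABLE over `L` at every `z ∈ 𝔹`, with
`Σ_{v ∈ L} vecFactor c₁ e v z ≤ A / (1 − |z|²)^m` for constants `A, m` depending on `(L, c₁, e)` only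
(`exists_vecFactor_tsum_le`).  Proof: `vecFactor ≤ K₁ (1 + ‖ι v‖)^k e^{−c₃ (1 − |z|²) ‖ι v‖²}` (the pointwise bound), the
image `ι(L)` is a discrete `ℤ`-submodule of the finite-dimensional real space `(E′ →+* ℂ) → Fin 3 → ℂ` (LatticeEmbed),
`e^{−u} ≤ s^s u^{−s}` (`Real.add_one_le_exp`) turns the Gaussian into an inverse power `‖ι v‖^{k − 2s}` with the
factor `(c₃ (1 − |z|²))^{−s}`, and Mathlib's `ZLattice.summable_norm_rpow` sums `‖x‖^{k − 2s}` over the lattice once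
`2s > k + rank`; the vector `0` contributes `K₁ ≤ K₁ (1 − |z|²)^{−s}`.

Nothing here asserts anything about the truth of (P); HC_CM is NOT proved by anyone in this repository.
-/

set_option autoImplicit false

noncomputable section

namespace Summit.Ventures.HodgeRepro.Tier4.Line3

open Matrix NumberField

/-- `0 ≤ gaussMaj` for `K₁ ≥ 0`. -/
theorem gaussMaj_nonneg {V : Type*} [NormedAddCommGroup V] {K₁ : ℝ} (hK : 0 ≤ K₁) (k a : ℝ) (x : V) :
    0 ≤ gaussMaj K₁ k a x := by
  unfold gaussMaj
  have : 0 ≤ 1 + ‖x‖ := by positivity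
  exact mul_nonneg (mul_nonneg hK (Real.rpow_nonneg this _)) (Real.exp_pos _).le

/-- `gaussMaj` at `0` is `K₁`. -/
theorem gaussMaj_zero {V : Type*} [NormedAddCommGroup V] (K₁ k a : ℝ) : gaussMaj K₁ k a (0 : V) = K₁ := by
  unfold gaussMaj
  simp

/-- `e^{−u} ≤ s^s u^{−s}` for `u > 0` and `s ≥ 1` (`u/s + 1 ≤ e^{u/s}`). -/
theorem exp_neg_le_rpow_neg {s : ℕ} (hs : 1 ≤ s) {u : ℝ} (hu : 0 < u) :
    Real.exp (-u) ≤ (s : ℝ) ^ (s : ℝ) * u ^ (-(s : ℝ)) := by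
  have hs' : (0 : ℝ) < s := by exact_mod_cast hs
  have h1 : u / s + 1 ≤ Real.exp (u / s) := Real.add_one_le_exp _
  have h2 : (u / s) ^ s ≤ Real.exp (u / s) ^ s :=
    pow_le_pow_left₀ (by positivity) (by linarith) s
  have h3 : Real.exp (u / s) ^ s = Real.exp u := by
    rw [← Real.exp_nat_mul, mul_div_cancel₀ _ hs'.ne']
  rw [h3] at h2
  have hpos : 0 < (u / s) ^ s := by positivity
  have h4 : Real.exp (-u) ≤ ((u / s) ^ s)⁻¹ := by
    rw [Real.exp_neg]
    exact inv_anti₀ hpos h2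
  refine h4.trans (le_of_eq ?_)
  rw [div_pow, inv_div, Real.rpow_neg hu.le, Real.rpow_natCast, Real.rpow_natCast]
  field_simp

/-- **THE INVERSE-POWER BOUND** off the origin: for `r ≤ ‖x‖`, `gaussMaj K₁ k a x ≤ K₂ a^{−s} ‖x‖^{k − 2s}` with
`K₂ = K₁ (1 + 1/r)^k s^s`. -/
theorem gaussMaj_le_rpow {V : Type*} [NormedAddCommGroup V] {K₁ k a r : ℝ} (hK : 0 ≤ K₁) (hk : 0 ≤ k) (ha : 0 < a)
    (hr : 0 < r) {s : ℕ} (hs : 1 ≤ s) {x : V} (hx : r ≤ ‖x‖) :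
    gaussMaj K₁ k a x ≤ (K₁ * (1 + 1 / r) ^ k * (s : ℝ) ^ (s : ℝ)) * a ^ (-(s : ℝ)) * ‖x‖ ^ (k - 2 * s) := by
  have hx0 : 0 < ‖x‖ := hr.trans_le hx
  -- the polynomial factor
  have h1 : 1 + ‖x‖ ≤ (1 + 1 / r) * ‖x‖ := by
    have : 1 ≤ ‖x‖ / r := (one_le_div hr).mpr hx
    have e : (1 + 1 / r) * ‖x‖ = ‖x‖ / r + ‖x‖ := by
      field_simp
      ring
    rw [e]
    linarith
  have h2 : (1 + ‖x‖) ^ k ≤ (1 + 1 / r) ^ k * ‖x‖ ^ k := by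
    rw [← Real.mul_rpow (by positivity) hx0.le]
    exact Real.rpow_le_rpow (by positivity) h1 hk
  -- the Gaussian factor
  have hu : 0 < a * ‖x‖ ^ 2 := by positivity
  have h3 : Real.exp (-(a * ‖x‖ ^ 2)) ≤ (s : ℝ) ^ (s : ℝ) * (a * ‖x‖ ^ 2) ^ (-(s : ℝ)) :=
    exp_neg_le_rpow_neg hs hu
  have h4 : (a * ‖x‖ ^ 2) ^ (-(s : ℝ)) = a ^ (-(s : ℝ)) * ‖x‖ ^ (-(2 * (s : ℝ))) := by
    rw [Real.mul_rpow ha.le (sq_nonneg _), ← Real.rpow_natCast ‖x‖ 2, ← Real.rpow_mul hx0.le]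
    congr 1
    push_cast
    ring_nf
  have h5 : ‖x‖ ^ k * ‖x‖ ^ (-(2 * (s : ℝ))) = ‖x‖ ^ (k - 2 * s) := by
    rw [← Real.rpow_add hx0]
    ring_nf
  have hss : 0 ≤ (s : ℝ) ^ (s : ℝ) := Real.rpow_nonneg (by positivity) _
  calc gaussMaj K₁ k a x = K₁ * (1 + ‖x‖) ^ k * Real.exp (-(a * ‖x‖ ^ 2)) := rfl
    _ ≤ K₁ * ((1 + 1 / r) ^ k * ‖x‖ ^ k) * ((s : ℝ) ^ (s : ℝ) * (a * ‖x‖ ^ 2) ^ (-(s : ℝ))) := by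
        refine mul_le_mul (mul_le_mul_of_nonneg_left h2 hK) h3 (Real.exp_pos _).le ?_
        exact mul_nonneg hK (mul_nonneg (Real.rpow_nonneg (by positivity) _) (Real.rpow_nonneg hx0.le _))
    _ = (K₁ * (1 + 1 / r) ^ k * (s : ℝ) ^ (s : ℝ)) * a ^ (-(s : ℝ)) * (‖x‖ ^ k * ‖x‖ ^ (-(2 * (s : ℝ)))) := by
        rw [h4]
        ring
    _ = _ := by rw [h5]

/-- **THE LATTICE SUM OF THE GAUSSIAN MAJORANT** over a discrete `ℤ`-submodule `Λ` of a finite-dimensional real normed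
space whose non-zero vectors have norm `≥ r`: summable, and
`Σ_{x ∈ Λ} gaussMaj K₁ k a x ≤ K₁ + K₂ a^{−s} Σ_{x ∈ Λ} ‖x‖^{k − 2s}` for every `s` with `2s > k + rank Λ`. -/
theorem tsum_gaussMaj_le {V : Type*} [NormedAddCommGroup V] [NormedSpace ℝ V] [FiniteDimensional ℝ V]
    (Λ : Submodule ℤ V) [DiscreteTopology Λ] {r : ℝ} (hr : 0 < r) (hΛ : ∀ x : Λ, x ≠ 0 → r ≤ ‖x‖)
    {K₁ k a : ℝ} (hK : 0 ≤ K₁) (hk : 0 ≤ k) (ha : 0 < a) {s : ℕ} (hs : 1 ≤ s)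
    (hks : k - 2 * s < -(Module.finrank ℤ Λ : ℝ)) :
    Summable (fun x : Λ => gaussMaj K₁ k a (x : V)) ∧
      ∑' x : Λ, gaussMaj K₁ k a (x : V) ≤
        K₁ + (K₁ * (1 + 1 / r) ^ k * (s : ℝ) ^ (s : ℝ)) * a ^ (-(s : ℝ)) * ∑' x : Λ, ‖x‖ ^ (k - 2 * s) := by
  classical
  set K₂ : ℝ := K₁ * (1 + 1 / r) ^ k * (s : ℝ) ^ (s : ℝ) with hK₂
  have hK₂0 : 0 ≤ K₂ := by
    rw [hK₂]
    exact mul_nonneg (mul_nonneg hK (Real.rpow_nonneg (by positivity) _)) (Real.rpow_nonneg (by positivity) _)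
  have hT : Summable fun x : Λ => ‖x‖ ^ (k - 2 * s) := ZLattice.summable_norm_rpow Λ _ hks
  -- the comparison function
  let h : Λ → ℝ := fun x => K₂ * a ^ (-(s : ℝ)) * ‖x‖ ^ (k - 2 * s) + (if x = 0 then K₁ else 0)
  have hh : Summable h := by
    refine (hT.mul_left _).add ?_
    exact summable_of_ne_finset_zero (s := {0}) fun x hx => by
      simp only [Finset.mem_singleton] at hx
      simp [hx]
  have hle : ∀ x : Λ, gaussMaj K₁ k a (x : V) ≤ h x := by
    intro x
    by_cases hx : x = 0
    · subst hx
      simp only [h, if_true, Submodule.coe_zero, gaussMaj_zero, norm_zero]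
      have hne : k - 2 * (s : ℝ) ≠ 0 := by
        have : (0 : ℝ) ≤ Module.finrank ℤ Λ := by positivity
        linarith
      rw [Real.zero_rpow hne]
      simp
    · have := gaussMaj_le_rpow (V := V) hK hk ha hr hs (hΛ x hx)
      simp only [h, hx, if_false, add_zero]
      exact this
  have hsum : Summable fun x : Λ => gaussMaj K₁ k a (x : V) :=
    Summable.of_nonneg_of_le (fun x => gaussMaj_nonneg hK _ _ _) hle hh
  refine ⟨hsum, ?_⟩
  have htsum : ∑' x : Λ, h x = K₂ * a ^ (-(s : ℝ)) * ∑' x : Λ, ‖x‖ ^ (k - 2 * s) + K₁ := by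
    simp only [h]
    rw [Summable.tsum_add (hT.mul_left _) (summable_of_ne_finset_zero (s := {0}) fun x hx => by
          simp only [Finset.mem_singleton] at hx
          simp [hx]),
      tsum_mul_left, tsum_ite_eq]
  calc ∑' x : Λ, gaussMaj K₁ k a (x : V) ≤ ∑' x : Λ, h x := Summable.tsum_le_tsum hle hsum hh
    _ = _ := by rw [htsum]; ring

namespace T4Data

variable (X : T4Data)

/-- **THE THETA BOUND OVER A LATTICE** (rung (R2)): for a finitely generated `𝒪_{E′}`-submodule `L ⊆ E′³` and `c₁ > 0`
the per-vector factors are summable over `L` at every point of the ball, with `Σ_{v ∈ L} vecFactor c₁ e v z ≤ A / (1 − |z|²)^m`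
for constants `A ≥ 0`, `m ≥ 0` depending on `(L, c₁, e)` only. -/
theorem exists_vecFactor_tsum_le (p : IsDedekindDomain.HeightOneSpectrum (RingOfIntegers X.E))
    {L : Submodule (RingOfIntegers X.E) (Fin 3 → X.E)} (hL : L.FG) {c₁ : ℝ} (hc₁ : 0 < c₁) (e : ℝ) :
    ∃ A m : ℝ, 0 ≤ A ∧ 0 ≤ m ∧ ∀ z ∈ ball,
      Summable (fun v : L => X.vecFactor c₁ e v z) ∧ ∑' v : L, X.vecFactor c₁ e v z ≤ A / (1 - nsq z) ^ m := by
  classical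
  haveI : DiscreteTopology (X.latt L) := X.discreteTopology_latt p hL
  obtain ⟨r, hr, hrL⟩ := X.norm_embV_ge p hL
  have hΛ : ∀ x : X.latt L, x ≠ 0 → r ≤ ‖x‖ := by
    intro x hx
    obtain ⟨v, hv, hvx⟩ := X.mem_latt.mp x.2
    have hv0 : v ≠ 0 := by
      intro h0
      apply hx
      apply Subtype.ext
      rw [← hvx, h0]
      exact map_zero X.embAdd
    have := hrL v hv hv0
    rw [hvx] at this
    exact this
  set k : ℝ := max e 0 + 2 with hk
  have hk0 : 0 ≤ k := by rw [hk]; positivity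
  set K₁ : ℝ := X.kPoly e with hK₁
  have hK₁0 : 0 ≤ K₁ := X.kPoly_nonneg e
  set c₃ : ℝ := X.cGauss c₁ with hc₃
  have hc₃0 : 0 < c₃ := X.cGauss_pos hc₁
  set s : ℕ := ⌈k⌉₊ + Module.finrank ℤ (X.latt L) + 1 with hs
  have hs1 : 1 ≤ s := by rw [hs]; omega
  have hks : k - 2 * s < -(Module.finrank ℤ (X.latt L) : ℝ) := by
    have h1 : k ≤ ⌈k⌉₊ := Nat.le_ceil k
    have h2 : (s : ℝ) = ⌈k⌉₊ + Module.finrank ℤ (X.latt L) + 1 := by rw [hs]; push_cast; ring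
    have h3 : (0 : ℝ) ≤ Module.finrank ℤ (X.latt L) := by positivity
    rw [h2]
    linarith
  set T : ℝ := ∑' x : X.latt L, ‖x‖ ^ (k - 2 * s) with hT
  set K₂ : ℝ := K₁ * (1 + 1 / r) ^ k * (s : ℝ) ^ (s : ℝ) with hK₂
  have hK₂0 : 0 ≤ K₂ := by
    rw [hK₂]
    exact mul_nonneg (mul_nonneg hK₁0 (Real.rpow_nonneg (by positivity) _)) (Real.rpow_nonneg (by positivity) _)
  have hT0 : 0 ≤ T := tsum_nonneg fun x => Real.rpow_nonneg (norm_nonneg _) _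
  refine ⟨K₁ + K₂ * c₃ ^ (-(s : ℝ)) * T, s, by positivity, by positivity, fun z hz => ?_⟩
  have hz1 : nsq z < 1 := hz
  have ht : 0 < 1 - nsq z := by linarith
  have ht1 : 1 - nsq z ≤ 1 := by
    have : 0 ≤ nsq z := by unfold nsq; positivity
    linarith
  set a : ℝ := c₃ * (1 - nsq z) with ha
  have ha0 : 0 < a := mul_pos hc₃0 ht
  -- the pointwise comparison through the lattice bijection
  have hle : ∀ v : L, X.vecFactor c₁ e v z ≤ gaussMaj K₁ k a ((X.lattEquiv L v : X.latt L) : (X.E →+* ℂ) → Fin 3 → ℂ) := by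
    intro v
    rw [X.lattEquiv_apply_coe]
    exact X.vecFactor_le hc₁ e v z hz
  obtain ⟨hsumΛ, hboundΛ⟩ := tsum_gaussMaj_le (X.latt L) hr hΛ hK₁0 hk0 ha0 hs1 hks
  have hsumL : Summable fun v : L => gaussMaj K₁ k a ((X.lattEquiv L v : X.latt L) : (X.E →+* ℂ) → Fin 3 → ℂ) :=
    (X.lattEquiv L).summable_iff.mpr hsumΛ
  have hsum : Summable fun v : L => X.vecFactor c₁ e v z :=
    Summable.of_nonneg_of_le (fun v => X.vecFactor_nonneg _ _ _ _) hle hsumL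
  refine ⟨hsum, ?_⟩
  have heq : ∑' v : L, gaussMaj K₁ k a ((X.lattEquiv L v : X.latt L) : (X.E →+* ℂ) → Fin 3 → ℂ) =
      ∑' x : X.latt L, gaussMaj K₁ k a (x : (X.E →+* ℂ) → Fin 3 → ℂ) :=
    (X.lattEquiv L).tsum_eq fun x : X.latt L => gaussMaj K₁ k a (x : (X.E →+* ℂ) → Fin 3 → ℂ)
  -- `a^{−s} = c₃^{−s} (1 − |z|²)^{−s}` and `(1 − |z|²)^{−s} ≥ 1`
  have hapow : a ^ (-(s : ℝ)) = c₃ ^ (-(s : ℝ)) * (1 - nsq z) ^ (-(s : ℝ)) := by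
    rw [ha, Real.mul_rpow hc₃0.le ht.le]
  have hone : 1 ≤ (1 - nsq z) ^ (-(s : ℝ)) :=
    Real.one_le_rpow_of_pos_of_le_one_of_nonpos ht ht1 (by simp)
  have hfinal : K₁ + K₂ * a ^ (-(s : ℝ)) * T ≤ (K₁ + K₂ * c₃ ^ (-(s : ℝ)) * T) * (1 - nsq z) ^ (-(s : ℝ)) := by
    rw [hapow]
    have hc : 0 ≤ K₂ * c₃ ^ (-(s : ℝ)) * T :=
      mul_nonneg (mul_nonneg hK₂0 (Real.rpow_nonneg hc₃0.le _)) hT0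
    nlinarith [mul_le_mul_of_nonneg_left hone hK₁0]
  calc ∑' v : L, X.vecFactor c₁ e v z
      ≤ ∑' v : L, gaussMaj K₁ k a ((X.lattEquiv L v : X.latt L) : (X.E →+* ℂ) → Fin 3 → ℂ) :=
        Summable.tsum_le_tsum hle hsum hsumL
    _ = ∑' x : X.latt L, gaussMaj K₁ k a (x : (X.E →+* ℂ) → Fin 3 → ℂ) := heq
    _ ≤ K₁ + K₂ * a ^ (-(s : ℝ)) * T := hboundΛ
    _ ≤ (K₁ + K₂ * c₃ ^ (-(s : ℝ)) * T) * (1 - nsq z) ^ (-(s : ℝ)) := hfinal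
    _ = (K₁ + K₂ * c₃ ^ (-(s : ℝ)) * T) / (1 - nsq z) ^ (s : ℝ) := by
        rw [Real.rpow_neg ht.le, div_eq_mul_inv]

end T4Data

end Summit.Ventures.HodgeRepro.Tier4.Line3

end
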